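import Summits.Schanuel.Schanuel.Theorems.ZilberEacGraphSurfaceDensity
import Summits.Schanuel.Schanuel.Theorems.ZilberEacFibreCurveDensity
import HarnessLib

/-!
# Arbitrary base branches, VI: the certificate for GRAPH FIBRES OVER AN ARBITRARY PLANE CURVE —
# `{A(x₀, x₁) = 0, y₀ = R(x₀, x₁)}` is an irreducible surface

HONEST FRAMING.  Cell `pub-schanuel` (Zilber's Exponential-Algebraic Closedness, case ladder;
host summit Schanuel), seat 2, gen 28.  To apply the master theorem of file V over a base curve
that is NOT rational one needs surfaces of Mantova–Masser's shape over it together with the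
certificate "irreducible, Zariski closed, of dimension `2`".  The simplest family: for an
irreducible `A ∈ ℂ[x₀, x₁]` (ANY irreducible affine plane curve `C = Z(A)`) and any
`R ∈ ℂ[x₀, x₁]`, the surface

  `S(A; R) = {(x₀, x₁, y₀, y₁) : A(x₀, x₁) = 0, y₀ = R(x₀, x₁)}` — the fibre over `x ∈ C` is the line
  `{R(x)} × ℂ`, i.e. `S(A; R)` is the cylinder over the graph of `R|_C`.

* **`curveGraphFibre_eq_zeroLocus`**: `S(A; R) = Z(θ⁻¹((Ã)))` for the SURJECTIVE substitution
  `θ : x₀ ↦ X₀, x₁ ↦ X₁, y₀ ↦ R(X₀, X₁), y₁ ↦ X₂` into `ℂ[X₀, X₁, X₂]` and `Ã = A(X₀, X₁)`;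
* **`isIrreducibleClosed_curveGraphFibre`**, **`zariskiDim_curveGraphFibre`** (`= 2`):
  `ℂ[S] ≅ ℂ[X₀, X₁, X₂]/(Ã)`.
(The pattern of file `ZilberEacGraphSurfaceDensity` for `{x₁ = p(x₀), P = 0}`, with the roles of
the graph coordinate moved from the base to the fibre.)  [folklore algebraic geometry]; nothing here
is specific to Schanuel's conjecture (neither used nor implied); Mantova–Masser's question
(PLMS 2024 §1 p. 5) and EC(3,2) stay OPEN.
-/

noncomputable section

open Set Complex MvPolynomial
open Literature.NumberTheory.Transcendental Literature.ModelTheory.Zilber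
open Literature.ModelTheory.ExponentialFields

set_option linter.dupNamespace false

namespace Summit.Schanuel.Schanuel.Theorems

section Certificate

variable (A R : MvPolynomial (Fin 2) ℂ)

/-- The substitution `θ` evaluated at `(w(x₀), w(x₁), w(y₁))` is evaluation at `w`, on variables,
for `w` with `w(y₀) = R(w(x₀), w(x₁))`. -/
theorem eval_curveGraphSubst {w : Fin 2 ⊕ Fin 2 → ℂ}
    (hw : w (Sum.inr 0) = MvPolynomial.eval ![w (Sum.inl 0), w (Sum.inl 1)] R) (v : Fin 2 ⊕ Fin 2) :
    eval ![w (Sum.inl 0), w (Sum.inl 1), w (Sum.inr 1)]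
      ((Sum.elim ![MvPolynomial.X 0, MvPolynomial.X 1]
        ![rename (Fin.castSucc : Fin 2 → Fin 3) R, MvPolynomial.X 2] :
          Fin 2 ⊕ Fin 2 → MvPolynomial (Fin 3) ℂ) v) = w v := by
  rcases v with i | i
  · fin_cases i
    · simp
    · simp
  · fin_cases i
    · show eval ![w (Sum.inl 0), w (Sum.inl 1), w (Sum.inr 1)]
        (rename (Fin.castSucc : Fin 2 → Fin 3) R) = w (Sum.inr 0)
      have e : ((![w (Sum.inl 0), w (Sum.inl 1), w (Sum.inr 1)] : Fin 3 → ℂ) ∘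
          (Fin.castSucc : Fin 2 → Fin 3)) = ![w (Sum.inl 0), w (Sum.inl 1)] := by
        funext j; fin_cases j <;> rfl
      rw [eval_rename, e, hw]
    · simp

/-- `θ` followed by evaluation at `(w(x₀), w(x₁), w(y₁))` is evaluation at `w`. -/
theorem eval_aeval_curveGraphSubst {w : Fin 2 ⊕ Fin 2 → ℂ}
    (hw : w (Sum.inr 0) = MvPolynomial.eval ![w (Sum.inl 0), w (Sum.inl 1)] R)
    (f : MvPolynomial (Fin 2 ⊕ Fin 2) ℂ) :
    eval ![w (Sum.inl 0), w (Sum.inl 1), w (Sum.inr 1)]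
      (aeval (Sum.elim ![MvPolynomial.X 0, MvPolynomial.X 1]
        ![rename (Fin.castSucc : Fin 2 → Fin 3) R, MvPolynomial.X 2] :
          Fin 2 ⊕ Fin 2 → MvPolynomial (Fin 3) ℂ) f) = aeval w f := by
  have h : (fun v => eval ![w (Sum.inl 0), w (Sum.inl 1), w (Sum.inr 1)]
      ((Sum.elim ![MvPolynomial.X 0, MvPolynomial.X 1]
        ![rename (Fin.castSucc : Fin 2 → Fin 3) R, MvPolynomial.X 2] :
          Fin 2 ⊕ Fin 2 → MvPolynomial (Fin 3) ℂ) v)) = w :=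
    funext (eval_curveGraphSubst R hw)
  rw [eval_aeval_eq_aeval, h]

/-- `θ` is onto (`X₀ ↦ x₀`, `X₁ ↦ x₁`, `X₂ ↦ y₁` is a section). -/
theorem curveGraphSubst_surjective : Function.Surjective
    (aeval (Sum.elim ![MvPolynomial.X 0, MvPolynomial.X 1]
        ![rename (Fin.castSucc : Fin 2 → Fin 3) R, MvPolynomial.X 2] :
          Fin 2 ⊕ Fin 2 → MvPolynomial (Fin 3) ℂ) :
      MvPolynomial (Fin 2 ⊕ Fin 2) ℂ →ₐ[ℂ] MvPolynomial (Fin 3) ℂ) := by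
  intro r
  let back : Fin 3 → Fin 2 ⊕ Fin 2 := ![Sum.inl 0, Sum.inl 1, Sum.inr 1]
  refine ⟨rename back r, ?_⟩
  rw [aeval_rename]
  have hX : ((Sum.elim ![MvPolynomial.X 0, MvPolynomial.X 1]
        ![rename (Fin.castSucc : Fin 2 → Fin 3) R, MvPolynomial.X 2] :
          Fin 2 ⊕ Fin 2 → MvPolynomial (Fin 3) ℂ) ∘ back) = MvPolynomial.X := by
    funext j
    fin_cases j <;> simp [back]
  rw [hX, MvPolynomial.aeval_X_left_apply]

/-- **`S(A; R) = Z(θ⁻¹((Ã)))`**, `Ã = A(X₀, X₁) ∈ ℂ[X₀, X₁, X₂]`. -/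
theorem curveGraphFibre_eq_zeroLocus :
    {w : Fin 2 ⊕ Fin 2 → ℂ | MvPolynomial.eval ![w (Sum.inl 0), w (Sum.inl 1)] A = 0 ∧
      w (Sum.inr 0) = MvPolynomial.eval ![w (Sum.inl 0), w (Sum.inl 1)] R} =
    zeroLocus ℂ (Ideal.comap (aeval (Sum.elim ![MvPolynomial.X 0, MvPolynomial.X 1]
        ![rename (Fin.castSucc : Fin 2 → Fin 3) R, MvPolynomial.X 2] :
          Fin 2 ⊕ Fin 2 → MvPolynomial (Fin 3) ℂ) :
        MvPolynomial (Fin 2 ⊕ Fin 2) ℂ →ₐ[ℂ] MvPolynomial (Fin 3) ℂ)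
      (Ideal.span {rename (Fin.castSucc : Fin 2 → Fin 3) A})) := by
  ext w
  rw [mem_zeroLocus_iff]
  constructor
  · rintro ⟨hwA, hwR⟩ f hf
    rw [Ideal.mem_comap, Ideal.mem_span_singleton] at hf
    obtain ⟨r, hr⟩ := hf
    rw [← eval_aeval_curveGraphSubst R hwR, hr, map_mul, eval_rename]
    have e : ((![w (Sum.inl 0), w (Sum.inl 1), w (Sum.inr 1)] : Fin 3 → ℂ) ∘
        (Fin.castSucc : Fin 2 → Fin 3)) = ![w (Sum.inl 0), w (Sum.inl 1)] := by
      funext j; fin_cases j <;> rfl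
    rw [e, hwA, zero_mul]
  · intro h
    have hwR : w (Sum.inr 0) = MvPolynomial.eval ![w (Sum.inl 0), w (Sum.inl 1)] R := by
      have hmem : (MvPolynomial.X (Sum.inr 0) - rename (Sum.inl : Fin 2 → Fin 2 ⊕ Fin 2) R :
          MvPolynomial (Fin 2 ⊕ Fin 2) ℂ) ∈
          Ideal.comap (aeval (Sum.elim ![MvPolynomial.X 0, MvPolynomial.X 1]
              ![rename (Fin.castSucc : Fin 2 → Fin 3) R, MvPolynomial.X 2] :
                Fin 2 ⊕ Fin 2 → MvPolynomial (Fin 3) ℂ) :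
              MvPolynomial (Fin 2 ⊕ Fin 2) ℂ →ₐ[ℂ] MvPolynomial (Fin 3) ℂ)
            (Ideal.span {rename (Fin.castSucc : Fin 2 → Fin 3) A}) := by
        rw [Ideal.mem_comap]
        have hfg : ((Sum.elim ![MvPolynomial.X 0, MvPolynomial.X 1]
            ![rename (Fin.castSucc : Fin 2 → Fin 3) R, MvPolynomial.X 2] :
              Fin 2 ⊕ Fin 2 → MvPolynomial (Fin 3) ℂ) ∘ (Sum.inl : Fin 2 → Fin 2 ⊕ Fin 2)) =
            MvPolynomial.X ∘ (Fin.castSucc : Fin 2 → Fin 3) := by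
          funext j; fin_cases j <;> rfl
        have e : aeval (Sum.elim ![MvPolynomial.X 0, MvPolynomial.X 1]
            ![rename (Fin.castSucc : Fin 2 → Fin 3) R, MvPolynomial.X 2] :
              Fin 2 ⊕ Fin 2 → MvPolynomial (Fin 3) ℂ)
            (MvPolynomial.X (Sum.inr 0) - rename (Sum.inl : Fin 2 → Fin 2 ⊕ Fin 2) R :
              MvPolynomial (Fin 2 ⊕ Fin 2) ℂ) = 0 := by
          rw [map_sub, MvPolynomial.aeval_X, aeval_rename, hfg, ← rename_eq_aeval (R := ℂ)]
          simp
        rw [e]; exact Ideal.zero_mem _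
      have h1 := h _ hmem
      rw [map_sub, MvPolynomial.aeval_X, sub_eq_zero, aeval_rename] at h1
      have e : (w ∘ (Sum.inl : Fin 2 → Fin 2 ⊕ Fin 2)) = ![w (Sum.inl 0), w (Sum.inl 1)] := by
        funext j; fin_cases j <;> rfl
      rw [h1, e]
      rfl
    refine ⟨?_, hwR⟩
    have hmem : (rename (Sum.inl : Fin 2 → Fin 2 ⊕ Fin 2) A : MvPolynomial (Fin 2 ⊕ Fin 2) ℂ) ∈
        Ideal.comap (aeval (Sum.elim ![MvPolynomial.X 0, MvPolynomial.X 1]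
            ![rename (Fin.castSucc : Fin 2 → Fin 3) R, MvPolynomial.X 2] :
              Fin 2 ⊕ Fin 2 → MvPolynomial (Fin 3) ℂ) :
            MvPolynomial (Fin 2 ⊕ Fin 2) ℂ →ₐ[ℂ] MvPolynomial (Fin 3) ℂ)
          (Ideal.span {rename (Fin.castSucc : Fin 2 → Fin 3) A}) := by
      have hfg : ((Sum.elim ![MvPolynomial.X 0, MvPolynomial.X 1]
          ![rename (Fin.castSucc : Fin 2 → Fin 3) R, MvPolynomial.X 2] :
            Fin 2 ⊕ Fin 2 → MvPolynomial (Fin 3) ℂ) ∘ (Sum.inl : Fin 2 → Fin 2 ⊕ Fin 2)) =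
          MvPolynomial.X ∘ (Fin.castSucc : Fin 2 → Fin 3) := by
        funext j; fin_cases j <;> rfl
      rw [Ideal.mem_comap, aeval_rename, hfg, ← rename_eq_aeval (R := ℂ)]
      exact Ideal.mem_span_singleton_self _
    have h1 := h _ hmem
    rw [aeval_rename] at h1
    have e : (w ∘ (Sum.inl : Fin 2 → Fin 2 ⊕ Fin 2)) = ![w (Sum.inl 0), w (Sum.inl 1)] := by
      funext j; fin_cases j <;> rfl
    rw [e] at h1
    rw [← MvPolynomial.coe_aeval_eq_eval]
    exact h1

variable {A}

/-- **`S(A; R)` is an irreducible closed set** for irreducible `A ∈ ℂ[x₀, x₁]`. (new) -/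
theorem isIrreducibleClosed_curveGraphFibre (hirr : Irreducible A) :
    IsIrreducibleClosed ℂ {w : Fin 2 ⊕ Fin 2 → ℂ |
      MvPolynomial.eval ![w (Sum.inl 0), w (Sum.inl 1)] A = 0 ∧
      w (Sum.inr 0) = MvPolynomial.eval ![w (Sum.inl 0), w (Sum.inl 1)] R} := by
  have hprime : Prime (rename (Fin.castSucc : Fin 2 → Fin 3) A) :=
    UniqueFactorizationMonoid.irreducible_iff_prime.1 (irreducible_rename_castSucc₂ hirr)
  haveI : (Ideal.span {rename (Fin.castSucc : Fin 2 → Fin 3) A} :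
      Ideal (MvPolynomial (Fin 3) ℂ)).IsPrime :=
    (Ideal.span_singleton_prime hprime.ne_zero).2 hprime
  haveI : (Ideal.comap (aeval (Sum.elim ![MvPolynomial.X 0, MvPolynomial.X 1]
        ![rename (Fin.castSucc : Fin 2 → Fin 3) R, MvPolynomial.X 2] :
          Fin 2 ⊕ Fin 2 → MvPolynomial (Fin 3) ℂ) :
        MvPolynomial (Fin 2 ⊕ Fin 2) ℂ →ₐ[ℂ] MvPolynomial (Fin 3) ℂ)
      (Ideal.span {rename (Fin.castSucc : Fin 2 → Fin 3) A})).IsPrime := Ideal.IsPrime.comap _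
  rw [curveGraphFibre_eq_zeroLocus]
  exact isIrreducibleClosed_zeroLocus _

/-- **`dim S(A; R) = 2`**: `ℂ[S] ≅ ℂ[X₀, X₁, X₂]/(Ã)`. (new) -/
theorem zariskiDim_curveGraphFibre (hirr : Irreducible A) :
    zariskiDim ℂ {w : Fin 2 ⊕ Fin 2 → ℂ |
      MvPolynomial.eval ![w (Sum.inl 0), w (Sum.inl 1)] A = 0 ∧
      w (Sum.inr 0) = MvPolynomial.eval ![w (Sum.inl 0), w (Sum.inl 1)] R} = (2 : ℕ) := by
  have hprime : Prime (rename (Fin.castSucc : Fin 2 → Fin 3) A) :=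
    UniqueFactorizationMonoid.irreducible_iff_prime.1 (irreducible_rename_castSucc₂ hirr)
  haveI : (Ideal.span {rename (Fin.castSucc : Fin 2 → Fin 3) A} :
      Ideal (MvPolynomial (Fin 3) ℂ)).IsPrime :=
    (Ideal.span_singleton_prime hprime.ne_zero).2 hprime
  haveI : (Ideal.comap (aeval (Sum.elim ![MvPolynomial.X 0, MvPolynomial.X 1]
        ![rename (Fin.castSucc : Fin 2 → Fin 3) R, MvPolynomial.X 2] :
          Fin 2 ⊕ Fin 2 → MvPolynomial (Fin 3) ℂ) :
        MvPolynomial (Fin 2 ⊕ Fin 2) ℂ →ₐ[ℂ] MvPolynomial (Fin 3) ℂ)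
      (Ideal.span {rename (Fin.castSucc : Fin 2 → Fin 3) A})).IsPrime := Ideal.IsPrime.comap _
  rw [curveGraphFibre_eq_zeroLocus, zariskiDim_zeroLocus_eq]
  set J : Ideal (MvPolynomial (Fin 3) ℂ) := Ideal.span {rename (Fin.castSucc : Fin 2 → Fin 3) A}
    with hJ
  let f : MvPolynomial (Fin 2 ⊕ Fin 2) ℂ →ₐ[ℂ] (MvPolynomial (Fin 3) ℂ ⧸ J) :=
    (Ideal.Quotient.mkₐ ℂ J).comp (aeval (Sum.elim ![MvPolynomial.X 0, MvPolynomial.X 1]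
        ![rename (Fin.castSucc : Fin 2 → Fin 3) R, MvPolynomial.X 2] :
          Fin 2 ⊕ Fin 2 → MvPolynomial (Fin 3) ℂ))
  have hf : Function.Surjective f :=
    (Ideal.Quotient.mkₐ_surjective ℂ J).comp (curveGraphSubst_surjective R)
  have hker : RingHom.ker f = Ideal.comap (aeval (Sum.elim ![MvPolynomial.X 0, MvPolynomial.X 1]
        ![rename (Fin.castSucc : Fin 2 → Fin 3) R, MvPolynomial.X 2] :
          Fin 2 ⊕ Fin 2 → MvPolynomial (Fin 3) ℂ) :
        MvPolynomial (Fin 2 ⊕ Fin 2) ℂ →ₐ[ℂ] MvPolynomial (Fin 3) ℂ) J := by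
    ext q
    simp only [RingHom.mem_ker, Ideal.mem_comap, f, AlgHom.comp_apply,
      Ideal.Quotient.mkₐ_eq_mk, Ideal.Quotient.eq_zero_iff_mem]
  rw [← hker, ringKrullDim_eq_of_ringEquiv (Ideal.quotientKerAlgEquivOfSurjective hf).toRingEquiv,
    hJ, Literature.RingTheory.KrullDimension.ringKrullDim_quotient_span_of_prime_mvPolynomial
      hprime]

end Certificate

end Summit.Schanuel.Schanuel.Theorems
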